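import Literature.Analysis.FluidPDE.KNSSTypeIIZoomIn
import Literature.Analysis.FluidPDE.KNSSBlowupLimit
import Literature.Analysis.FluidPDE.LerayHopfNSRescale
import Summits.NavierStokesRegularity.NavierStokesRegularity.Theorems.PlaneEnergyCeilingBoundedPlanarEnergyRegularityZoomWindowLipschitz
import Summits.NavierStokesRegularity.NavierStokesRegularity.Theorems.PlaneEnergyCeilingBoundedPlanarEnergyRegularityZoomFinalTime
import HarnessLib

/-!
# Route PlaneEnergyCeiling · crux `BoundedPlanarEnergyRegularity` — zoom stub, step 3:
# the KNSS velocity-record zoom of a finite-energy classical blow-up and its pointwise limit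

Helper file for the crux item stmt-NavierStokesRegularity-16921 (`BoundedPlanarEnergyRegularity`),
serving the zoom stub `stub_planarEnergyZoom` (= support item stmt-NavierStokesRegularity-16858) of
its line `birth`. It is the finite-energy form of the zoom-in of Koch–Nadirashvili–Seregin–Šverák
2009 (Acta Math. 203, §6: the rescaling procedure (6.2)–(6.3) before Prop. 6.1, Lemma 6.1, and
the proof of Thm. 6.1, arXiv:0709.3599 pp. 11–12), assembled from the tree's proof of Thm. 6.1
(`KNSSTypeIIProofs.lean`) with the axisymmetric decay `|x'| |u| ≤ C` replaced by
square-integrability of the slices (`lipschitz_of_memLp_two`, `lipschitz_up_to_final_time_of_memLp`).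

**Statement (`exists_zoom_limit_of_memLp_two`).** Let `(u, p)` be a classical solution of the
unforced system (`ν = 1`) on `(0, T) × ℝ³`, bounded on every `(0, T') × ℝ³`, `T' < T`, NOT bounded
on `(0, T) × ℝ³`, with square-integrable slices `u(t) ∈ L²(ℝ³)`. Then there are near-record
points `(t_n, x_n)`, scales `c_n = ‖u(t_n, x_n)‖⁻¹ > 0` with `A_n = −t_n/c_n² → −∞`, and a field
`v` such that the rescaled velocities `V_n(s, y) = c_n u(t_n + c_n² s, x_n + c_n y)` are bounded by
`2` on `(A_n, 0] × ℝ³` and converge POINTWISE on `(−∞, 0] × ℝ³` to `v`; `v` is continuous,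
bounded by `2`, `‖v(0, 0)‖ = 1`, not identically zero on the open slab `(−∞, 0) × ℝ³`, and a
bounded weak solution of Navier–Stokes (`ν = 1`) on `(−∞, 0)`.

Proof (KNSS p. 12, as in `KNSS2009_regularity_bound_C_over_r_one`): near-maxima
(`exists_near_max`), the rescaled classical solutions centred AT the near-maximum
(`IsClassicalNSSolutionOn.nsRescale_translate_zero`), their bound `2` up to `s = 0`, their
square-integrable slices (scaling), the uniform Lipschitz bound on `[A_n + 1, 0] × ℝ³`
(`lipschitz_of_memLp_two`, `lipschitz_up_to_final_time_of_memLp`), clamping and pointwise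
Arzelà–Ascoli (`lipschitzWith_clamp`, `exists_strictMono_tendsto_of_lipschitzWith`), the limit
bounded weak solution (`isBoundedWeakNSSolutionOn_of_tendsto`), and `‖v(0,0)‖ = 1` with the
Lipschitz bound for non-triviality on the open slab.

References: Koch–Nadirashvili–Seregin–Šverák 2009, §6 (arXiv:0709.3599 pp. 11–12).
[KochNadirashviliSereginSverak2009]
-/

noncomputable section

-- single-conjunct summit: `Summit.<Summit>.<Problem>` repeats the name by the D-0017 layout
set_option linter.dupNamespace false

namespace Summit.NavierStokesRegularity.NavierStokesRegularity.Theorems.BoundedPlanarEnergyRegularity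

open MeasureTheory Set Function Filter Topology TopologicalSpace Metric
open scoped NNReal ENNReal
open Literature.Analysis.FluidPDE

/-- **Square-integrability is invariant under the KNSS rescaling of a slice**:
`u(t) ∈ L²(ℝ³) ⇒ (y ↦ c • u(t, x₀ + c y)) ∈ L²(ℝ³)` for `c ≠ 0` (translation invariance and
`Measure.map_addHaar_smul`). -/
theorem memLp_two_zoom_slice {w : EuclideanSpace ℝ (Fin 3) → EuclideanSpace ℝ (Fin 3)}
    (hw : MemLp w 2 volume) (x₀ : EuclideanSpace ℝ (Fin 3)) {c : ℝ} (hc : c ≠ 0) :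
    MemLp (fun y => c • w (x₀ + c • y)) 2 volume := by
  have h1 : MemLp (fun z => w (x₀ + z)) 2 volume :=
    hw.comp_measurePreserving (measurePreserving_add_left volume x₀)
  have h2 : MemLp (fun y => w (x₀ + c • y)) 2 volume := memLp_comp_smul_of_ne_zero h1 hc
  exact h2.const_smul c

-- adapted from Literature/Analysis/FluidPDE/KNSSTypeIIProofs.lean
-- (KNSS2009_regularity_bound_C_over_r_one, the zoom-in of the proof of KNSS Thm 6.1)
/-- **The KNSS velocity-record zoom of a finite-energy classical blow-up and its pointwise limit**
(KNSS 2009, §6, (6.2)–(6.3), Lemma 6.1 and the proof of Thm. 6.1, finite-energy version; module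
docstring). For a classical solution `(u,p)` (`ν = 1`) on `(0,T) × ℝ³`, bounded before `T`, not
bounded up to `T`, with square-integrable slices: near-record points `(t_n, x_n)`, scales
`c_n > 0` with `−t_n/c_n² → −∞`, rescaled velocities `c_n u(t_n + c_n² s, x_n + c_n y)` bounded by
`2` on `(−t_n/c_n², 0]` and converging pointwise on `(−∞, 0] × ℝ³` to a continuous `v` with
`‖v‖ ≤ 2`, `‖v(0,0)‖ = 1`, `v ≢ 0` on `(−∞,0) × ℝ³`, `v` a bounded weak solution on `(−∞, 0)`. -/
theorem exists_zoom_limit_of_memLp_two :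
    ∀ (T : ℝ) (u : ℝ → EuclideanSpace ℝ (Fin 3) → EuclideanSpace ℝ (Fin 3))
      (p : ℝ → EuclideanSpace ℝ (Fin 3) → ℝ), 0 < T →
      Literature.Analysis.FluidPDE.IsClassicalNSSolutionOn (Set.Ioo 0 T) 1 0 u p →
      (∀ T' < T, ∃ M : ℝ, ∀ t ∈ Set.Ioo 0 T', ∀ x, ‖u t x‖ ≤ M) →
      (¬ ∃ M : ℝ, ∀ t ∈ Set.Ioo 0 T, ∀ x, ‖u t x‖ ≤ M) →
      (∀ t ∈ Set.Ioo 0 T, MeasureTheory.MemLp (u t) 2 MeasureTheory.volume) →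
      ∃ (v : ℝ → EuclideanSpace ℝ (Fin 3) → EuclideanSpace ℝ (Fin 3)) (tn : ℕ → ℝ)
        (xn : ℕ → EuclideanSpace ℝ (Fin 3)) (c : ℕ → ℝ),
        (∀ n, tn n ∈ Set.Ioo 0 T) ∧ (∀ n, 0 < c n) ∧
        Filter.Tendsto (fun n => -(tn n / c n ^ 2)) Filter.atTop Filter.atBot ∧
        (∀ n, ∀ s ∈ Set.Ioc (-(tn n / c n ^ 2)) 0, ∀ y,
          ‖(c n • Literature.Analysis.FluidPDE.stPull (c n ^ 2) (c n) (tn n) (xn n) u) s y‖ ≤ 2) ∧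
        (∀ t ≤ 0, ∀ x, Filter.Tendsto
          (fun n => (c n • Literature.Analysis.FluidPDE.stPull (c n ^ 2) (c n) (tn n) (xn n) u) t x)
          Filter.atTop (nhds (v t x))) ∧
        Continuous (Function.uncurry v) ∧
        (∀ t ≤ 0, ∀ x, ‖v t x‖ ≤ 2) ∧
        ‖v 0 0‖ = 1 ∧
        (∃ t < 0, ∃ x, v t x ≠ 0) ∧
        Literature.Analysis.FluidPDE.IsBoundedWeakNSSolutionOn (Set.Iio 0) isOpen_Iio 1 v := by
  intro T u p hT h hbdd hunb hL2u
  -- the uniform Lipschitz constant on unit windows (§4) at the bound `2`, finite-energy version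
  obtain ⟨K, hK0, hKprop⟩ := lipschitz_of_memLp_two 2
  -- a bound on `(0, 3T/4) × ℝ³`
  obtain ⟨Bbar, hBbar⟩ := hbdd (3 * T / 4) (by linarith)
  -- the near-maxima
  have hsel := fun n : ℕ => exists_near_max hbdd hunb (((n : ℝ) + 3) * (1 + 1 / T) + |Bbar|)
  choose tn htn xn hR hmax using hsel
  set M : ℕ → ℝ := fun n => ‖u (tn n) (xn n)‖ with hMdef
  have hRpos : ∀ n : ℕ, (3 : ℝ) ≤ ((n : ℝ) + 3) * (1 + 1 / T) := fun n => by
    have h1 : (1 : ℝ) ≤ 1 + 1 / T := by simp [hT.le]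
    nlinarith [n.cast_nonneg (α := ℝ)]
  have hM1 : ∀ n : ℕ, ((n : ℝ) + 3) * (1 + 1 / T) ≤ M n := fun n => by
    have := hR n; linarith [abs_nonneg Bbar]
  have hMone : ∀ n, 1 ≤ M n := fun n => by linarith [hRpos n, hM1 n]
  have hMpos : ∀ n, 0 < M n := fun n => by linarith [hMone n]
  have htn34 : ∀ n, 3 * T / 4 ≤ tn n := fun n => by
    by_contra hlt
    push Not at hlt
    have h1 : M n ≤ Bbar := hBbar (tn n) ⟨(htn n).1, hlt⟩ (xn n)
    have h2 : |Bbar| < M n := by have := hR n; linarith [hRpos n]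
    linarith [le_abs_self Bbar]
  -- the scaling factors and the time intervals of the rescaled solutions
  set c : ℕ → ℝ := fun n => (M n)⁻¹ with hcdef
  have hcpos : ∀ n, 0 < c n := fun n => inv_pos.2 (hMpos n)
  set A : ℕ → ℝ := fun n => -(tn n / c n ^ 2) with hAdef
  set B : ℕ → ℝ := fun n => (T - tn n) / c n ^ 2 with hBdef
  have hAle : ∀ n : ℕ, A n ≤ -(((n : ℝ) + 3) * (3 / 4)) := fun n => by
    have hA' : A n = -(tn n * M n ^ 2) := by
      simp only [hAdef, hcdef, inv_pow, div_inv_eq_mul]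
    rw [hA', neg_le_neg_iff]
    have h1 : ((n : ℝ) + 3) * (1 + 1 / T) * 1 ≤ M n * M n :=
      mul_le_mul (hM1 n) (hMone n) zero_le_one (hMpos n).le
    have h2 : T * (1 + 1 / T) = T + 1 := by field_simp
    have h3 : 3 * T / 4 * (((n : ℝ) + 3) * (1 + 1 / T)) ≤ tn n * M n ^ 2 := by
      rw [sq]
      exact mul_le_mul (htn34 n) (by simpa using h1) (by nlinarith [hRpos n]) (htn n).1.le
    have h4 : 3 * T / 4 * (((n : ℝ) + 3) * (1 + 1 / T)) = ((n : ℝ) + 3) * (3 / 4) * (T + 1) := by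
      rw [← h2]; ring
    nlinarith [n.cast_nonneg (α := ℝ)]
  have hA2 : ∀ n, A n ≤ -2 := fun n => by nlinarith [hAle n, n.cast_nonneg (α := ℝ)]
  have hBpos : ∀ n, 0 < B n := fun n => div_pos (by linarith [(htn n).2]) (pow_pos (hcpos n) 2)
  have hAtend : Tendsto A atTop atBot := by
    refine tendsto_atBot_mono hAle (tendsto_neg_atTop_atBot.comp ?_)
    exact (tendsto_natCast_atTop_atTop.atTop_add tendsto_const_nhds).atTop_mul_const (by norm_num)
  -- the rescaled solutions (6.2), centred at the near-maxima
  set V : ℕ → ℝ → EuclideanSpace ℝ (Fin 3) → EuclideanSpace ℝ (Fin 3) :=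
    fun n => c n • stPull (c n ^ 2) (c n) (tn n) (xn n) u with hVdef
  set P : ℕ → ℝ → EuclideanSpace ℝ (Fin 3) → ℝ :=
    fun n => c n ^ 2 • stPull (c n ^ 2) (c n) (tn n) (xn n) p with hPdef
  have hVcl : ∀ n, IsClassicalNSSolutionOn (Ioo (A n) (B n)) 1 0 (V n) (P n) := fun n =>
    (h.nsRescale_translate_zero (hcpos n) (tn n) (xn n)).mono
      (fun _ hs => zoom_time_mem (hcpos n).ne' hs) (uniqueDiffOn_Ioo _ _)
  have hVbd : ∀ n, ∀ s ∈ Ioc (A n) 0, ∀ y, ‖V n s y‖ ≤ 2 := by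
    intro n s hs y
    simp only [hVdef, smul_stPull_apply]
    rw [norm_smul, Real.norm_eq_abs, abs_of_pos (hcpos n)]
    have h1 := hmax n _ (zoom_time_mem_Ioc (hcpos n).ne' hs) (xn n + c n • y)
    calc c n * ‖u (tn n + c n ^ 2 * s) (xn n + c n • y)‖ ≤ c n * (2 * ‖u (tn n) (xn n)‖) :=
          mul_le_mul_of_nonneg_left h1 (hcpos n).le
      _ = 2 := by
          rw [hcdef]
          show (M n)⁻¹ * (2 * M n) = 2
          field_simp [(hMpos n).ne']
  have hVmem : ∀ n, ∀ s ∈ Ioo (A n) (B n), tn n + c n ^ 2 * s ∈ Ioo 0 T := fun n s hs =>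
    zoom_time_mem (hcpos n).ne' hs
  have hVL2 : ∀ n, ∀ s ∈ Ioo (A n) (B n), MemLp (V n s) 2 volume := by
    intro n s hs
    show MemLp (fun y => c n • u (tn n + c n ^ 2 * s) (xn n + c n • y)) 2 volume
    exact memLp_two_zoom_slice (hL2u _ (hVmem n s hs)) (xn n) (hcpos n).ne'
  have hVone : ∀ n, ‖V n 0 0‖ = 1 := fun n => by
    simp only [hVdef, smul_stPull_apply, mul_zero, add_zero, smul_zero]
    rw [norm_smul, Real.norm_eq_abs, abs_of_pos (hcpos n), hcdef]
    exact inv_mul_cancel₀ (hMpos n).ne'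
  have hVcont : ∀ n, ContinuousOn (uncurry (V n)) (Ioo (A n) (B n) ×ˢ univ) := fun n =>
    (hVcl n).smooth_velocity.continuousOn
  -- uniform Lipschitz bound on `[A n + 1, 0] × ℝ³`, and the clamped maps
  have hLip : ∀ n, ∀ s ∈ Icc (A n + 1) 0, ∀ t ∈ Icc (A n + 1) 0, ∀ x y,
      ‖V n t x - V n s y‖ ≤ max K 8 * (|t - s| + ‖x - y‖) := fun n =>
    lipschitz_up_to_final_time_of_memLp K hKprop (A n) (B n) (hA2 n) (hBpos n) (V n) (P n)
      (hVcl n) (hVbd n) (hVL2 n)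
  set W : ℕ → ℝ × EuclideanSpace ℝ (Fin 3) → EuclideanSpace ℝ (Fin 3) :=
    fun n z => V n (max (A n + 1) (min z.1 0)) z.2 with hWdef
  have hK8 : 0 ≤ max K 8 := hK0.trans (le_max_left _ _)
  have hWlip : ∀ n, LipschitzWith (Real.toNNReal (2 * max K 8)) (W n) := fun n =>
    lipschitzWith_clamp hK8 (by linarith [hA2 n]) (hLip n)
  have hclamp : ∀ n (r : ℝ), max (A n + 1) (min r 0) ∈ Ioc (A n) 0 := fun n r =>
    ⟨by linarith [le_max_left (A n + 1) (min r 0)], max_le (by linarith [hA2 n]) (min_le_right _ _)⟩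
  have hWball : ∀ n z, W n z ∈ closedBall (0 : EuclideanSpace ℝ (Fin 3)) 2 := fun n z =>
    mem_closedBall_zero_iff.2 (hVbd n _ (hclamp n z.1) z.2)
  -- extraction: pointwise convergence of the clamped maps
  obtain ⟨θ, Winf, hθ, hWinflip, -, hWconv⟩ :=
    exists_strictMono_tendsto_of_lipschitzWith W hWlip hWball
  have hAθ : Tendsto (fun m => A (θ m)) atTop atBot := hAtend.comp hθ.tendsto_atTop
  have hevA : ∀ t : ℝ, ∀ᶠ m in atTop, A (θ m) + 1 ≤ t := fun t =>
    (hAθ.eventually (eventually_le_atBot (t - 1))).mono fun m hm => by linarith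
  -- the limit field
  set v : ℝ → EuclideanSpace ℝ (Fin 3) → EuclideanSpace ℝ (Fin 3) := fun t x => Winf (t, x)
    with hvdef
  have hvcont : Continuous (uncurry v) := hWinflip.continuous
  have hVlim : ∀ t ≤ 0, ∀ x, Tendsto (fun m => V (θ m) t x) atTop (𝓝 (v t x)) := by
    intro t ht x
    refine (hWconv (t, x)).congr' ((hevA t).mono fun m hm => ?_)
    show V (θ m) (max (A (θ m) + 1) (min t 0)) x = V (θ m) t x
    rw [min_eq_left ht, max_eq_right hm]
  -- the limit is a bounded weak solution on `(-∞, 0)`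
  have hweak : IsBoundedWeakNSSolutionOn (Iio 0) isOpen_Iio 1 v := by
    refine isBoundedWeakNSSolutionOn_of_tendsto (A := fun m => A (θ m)) (V := fun m => V (θ m))
      (M := 2) hAθ (fun m => ?_) (fun m => ?_) (fun m s hs y => hVbd (θ m) s ⟨hs.1, hs.2.le⟩ y)
      hvcont (fun t ht x => hVlim t ht.le x)
    · have hcl : IsClassicalNSSolutionOn (Ioo (A (θ m)) 0) 1 0 (V (θ m)) (P (θ m)) :=
        (hVcl (θ m)).mono (Ioo_subset_Ioo_right (hBpos _).le) (uniqueDiffOn_Ioo _ _)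
      exact hcl.isBoundedWeakNSSolutionOn ⟨2, fun s hs y => hVbd (θ m) s ⟨hs.1, hs.2.le⟩ y⟩
    · exact (hVcont (θ m)).mono (prod_mono (Ioo_subset_Ioo_right (hBpos _).le) Subset.rfl)
  -- the bound and the unit value pass to the limit
  have hvbd : ∀ t ≤ 0, ∀ x, ‖v t x‖ ≤ 2 := by
    intro t ht x
    refine le_of_tendsto (hVlim t ht x).norm ((hevA t).mono fun m hm => ?_)
    exact hVbd (θ m) t ⟨by linarith, ht⟩ x
  have hv1 : ‖v 0 0‖ = 1 := by
    have h1 : Tendsto (fun m => ‖V (θ m) 0 0‖) atTop (𝓝 ‖v 0 0‖) := (hVlim 0 le_rfl 0).norm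
    refine tendsto_nhds_unique h1 ?_
    simp_rw [hVone]
    exact tendsto_const_nhds
  -- non-triviality on the open slab, from the Lipschitz bound
  have hnz : ∃ t < 0, ∃ x, v t x ≠ 0 := by
    set k : ℝ := 2 * max K 8 with hk
    have hkpos : 0 < k := by rw [hk]; positivity
    set t₀ : ℝ := -(1 / (2 * k)) with ht₀
    have ht₀neg : t₀ < 0 := by rw [ht₀]; exact neg_neg_of_pos (by positivity)
    refine ⟨t₀, ht₀neg, 0, fun h0 => ?_⟩
    have hd : dist (Winf (t₀, 0)) (Winf (0, 0)) ≤ k * |t₀| := by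
      have := hWinflip.dist_le_mul ((t₀, (0 : EuclideanSpace ℝ (Fin 3)))) ((0 : ℝ), 0)
      rw [Real.coe_toNNReal _ hkpos.le, Prod.dist_eq, dist_self, Real.dist_eq, sub_zero,
        max_eq_left (abs_nonneg _)] at this
      exact this
    have habs : k * |t₀| = 1 / 2 := by
      rw [ht₀, abs_neg, abs_of_pos (by positivity)]
      field_simp
    have hv0 : Winf (t₀, 0) = 0 := h0
    rw [hv0, dist_comm, dist_zero_right, habs] at hd
    have : ‖Winf (0, 0)‖ = 1 := hv1
    linarith
  exact ⟨v, fun m => tn (θ m), fun m => xn (θ m), fun m => c (θ m), fun m => htn (θ m),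
    fun m => hcpos (θ m), hAθ, fun m => hVbd (θ m), hVlim, hvcont, hvbd, hv1, hnz, hweak⟩

end Summit.NavierStokesRegularity.NavierStokesRegularity.Theorems.BoundedPlanarEnergyRegularity

end
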